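import Literature.AnabelianGeometry.SemiGraphs.InterfaceVocab
import Literature.AnabelianGeometry.AbsoluteAnabelian.ProfiniteTerminology
import Mathlib.Topology.Algebra.OpenSubgroup

/-!
# Arithmetic semi-graphs of anabelioids ([SemiAnbd] §5, Definition 5.1 (i)–(iv))

Mochizuki, *Semi-graphs of anabelioids*, Publ. RIMS **42** (2006), §5 pp.62–63 of the author's
manuscript (kurims `paper:url-f33ace170ff4`) — the item of [SemiAnbd] most cited by [IUTchI]
(×9). [cite: MochizukiSemiAnbd2006, Def 5.1, p. 62]

Typed over the §§1–3 interface `SemiAnbdVocab` (file `InterfaceVocab.lean`; TODO-merge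
abc-iut-L3-t1/t2): one declaration per printed sub-item.

* Def 5.1 (i): an *action* `ρ_𝔾 : π̂₁(A) → Aut(𝔾)` of the fundamental group of a slim connected
  anabelioid `A` (with basepoint) on a connected, coherent, totally aloof, verticially slim
  semi-graph of anabelioids `𝔾`, and its *continuity* = conditions (a)–(d) for some open subgroup
  `H ⊆ π̂₁(A)` — `AbsoluteAnabelian.IsTopologicallyFinitelyGenerated` (a, REUSED from the tree),
  `SemiAnbdVocab.IsLocallyFinite` (b), `Def51CondC` (c),
  `Def51CondD` (d), bundled in `IsContinuousActionAt` / `IsContinuousAction`.  The anabelioid `A`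
  enters through its profinite fundamental group `PA = π̂₁(A)` (a bundled `ProfiniteGrp`; "equipped
  with a basepoint, so we may speak of `π̂₁(A)`", p.62), slimness of `A` as slimness of `PA`
  (§0 p.6: "`B(G)` is slim iff `Z_G(H) = {1}` for every open `H`" = `IsSlimGroup` of the
  Frobenioids §0 file).
* [IUTchI] Rmk 2.5.3 (vi) (kurims ms pp.55–56) strengthens (c), (d) to component-wise conditions
  (c^new), (d^new) "in order to carry out the argument stated in the proof of Prop 5.2 (i)", and
  observes (O3) that (c), (c^new) hold automatically since `H` is topologically finitely generated
  [NS]; (d^new) is typed (`Def51CondDNew`); (c^new) needs the profinite topology (O2) on `Aut(𝔾[c])`,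
  which is not part of the interface — recorded here, not typed.
* Def 5.1 (ii): `ArithSemiGraph` = a connected arithmetic semi-graph of anabelioids
  `𝔊 = (𝔾, A, ρ_𝔾)`; geometric component `.G`, arithmetic component `.PA`, arithmetic action `.ρ`.
* Def 5.1 (iii): `ArithSemiGraphFamily` (a formal collection of connected ones) with the
  component-wise adjectives the interface can express (finite, totally elevated, totally
  universally sub-coverticial, totally estranged; "totally aloof" holds for every object of the
  ambient category).  The per-vertex / per-edge variants ("elevated at a vertex", "sub-coverticial
  at a closed edge", …) are the same sentences over t1's local predicates — TODO-merge, listed not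
  typed.
* Def 5.1 (iv): `ArithHom` = a pair (continuous `π̂₁(A') → π̂₁(A)`, `𝔾' → 𝔾`) compatible with the
  actions, `ArithHom.InnerEquiv` = "regarded up to composition with the inner action of `π̂₁(A)`";
  the nine classes of morphisms (finite étale, tempered, locally trivial, locally open, locally
  finite étale, immersive, excisive, embedding, BC-finite étale) in the connected case; the
  general case (`ArithFamilyHom`, fibre conditions) opens `ArithmeticCoverings.lean`.
  TODO(general form): the text allows an ARBITRARY 1-morphism of semi-graphs of anabelioids as
  geometric component and only remarks that for locally open ones "we may work with such morphisms
  as if they are morphisms in a category" (p.63, Rmk 2.4.2; [IUTchI] Rmk 2.5.3 (iii) adds: every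
  edge abuts to a vertex); here the geometric component is an arrow of the ambient 1-category of
  the interface, i.e. the locally open case.

Arithmetic-component dictionary (connected anabelioids ↔ profinite groups up to inner
automorphism, §2 p.22): "finite étale `A' → A`" = injective with open image; "isomorphism" =
bijective; "composite of a `π₁`-epimorphism with a finite étale morphism" = open image.
Nothing in this file asserts a result of the paper.
-/

namespace Literature.AnabelianGeometry.SemiGraphs

open _root_.CategoryTheory Literature.AlgebraicGeometry.Frobenioids Literature.AnabelianGeometry

universe u v w

variable {Obj : Type u} [Category.{v} Obj] (𝓥 : SemiAnbdVocab.{u, v, w} Obj)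

namespace SemiAnbdVocab

/-- An automorphism `φ` of `G` fixing the vertex `v` induces an automorphism of `G[v]`
(functoriality of localization; used in Def 5.1 (i)(d) "compatible with the action of `H` on both
sides"). [cite: MochizukiSemiAnbd2006, Def 5.1 (i)(d), p. 62] -/
def locAutV {G : Obj} (φ : Aut G) (v : 𝓥.Vert G) (h : 𝓥.mapV φ.hom v = v) :
    Aut (𝓥.locV G v) where
  hom := 𝓥.locMapV φ.hom v v h
  inv := 𝓥.locMapV φ.inv v v (by
    have h' := 𝓥.mapV_comp φ.hom φ.inv v
    rw [φ.hom_inv_id, 𝓥.mapV_id, h] at h'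
    exact h'.symm)
  hom_inv_id := by
    rw [← 𝓥.locMapV_comp φ.hom φ.inv v v v h _ (by rw [φ.hom_inv_id, 𝓥.mapV_id])]
    have : ∀ (h₃ : 𝓥.mapV (φ.hom ≫ φ.inv) v = v),
        𝓥.locMapV (φ.hom ≫ φ.inv) v v h₃ = 𝟙 _ := by
      rw [φ.hom_inv_id]; intro h₃; exact 𝓥.locMapV_id G v h₃
    exact this _
  inv_hom_id := by
    rw [← 𝓥.locMapV_comp φ.inv φ.hom v v v _ h (by rw [φ.inv_hom_id, 𝓥.mapV_id])]
    have : ∀ (h₃ : 𝓥.mapV (φ.inv ≫ φ.hom) v = v),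
        𝓥.locMapV (φ.inv ≫ φ.hom) v v h₃ = 𝟙 _ := by
      rw [φ.inv_hom_id]; intro h₃; exact 𝓥.locMapV_id G v h₃
    exact this _

/-- An automorphism `φ` of `G` fixing the edge `e` induces an automorphism of `G[e]`
(used in the component-wise condition (d^new) of [IUTchI] Rmk 2.5.3 (vi)).
[cite: MochizukiSemiAnbd2006, Def 5.1 (i)(d), p. 62] -/
def locAutE {G : Obj} (φ : Aut G) (e : 𝓥.Edge G) (h : 𝓥.mapE φ.hom e = e) :
    Aut (𝓥.locE G e) where
  hom := 𝓥.locMapE φ.hom e e h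
  inv := 𝓥.locMapE φ.inv e e (by
    have h' := 𝓥.mapE_comp φ.hom φ.inv e
    rw [φ.hom_inv_id, 𝓥.mapE_id, h] at h'
    exact h'.symm)
  hom_inv_id := by
    rw [← 𝓥.locMapE_comp φ.hom φ.inv e e e h _ (by rw [φ.hom_inv_id, 𝓥.mapE_id])]
    have : ∀ (h₃ : 𝓥.mapE (φ.hom ≫ φ.inv) e = e),
        𝓥.locMapE (φ.hom ≫ φ.inv) e e h₃ = 𝟙 _ := by
      rw [φ.hom_inv_id]; intro h₃; exact 𝓥.locMapE_id G e h₃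
    exact this _
  inv_hom_id := by
    rw [← 𝓥.locMapE_comp φ.inv φ.hom e e e _ h (by rw [φ.inv_hom_id, 𝓥.mapE_id])]
    have : ∀ (h₃ : 𝓥.mapE (φ.inv ≫ φ.hom) e = e),
        𝓥.locMapE (φ.inv ≫ φ.hom) e e h₃ = 𝟙 _ := by
      rw [φ.inv_hom_id]; intro h₃; exact 𝓥.locMapE_id G e h₃
    exact this _

end SemiAnbdVocab

/-! ### Definition 5.1 (i): actions and their continuity -/

section Def51

variable (G : Obj) (PA : ProfiniteGrp.{w}) (ρ : PA →* Aut G)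

/-- **Def 5.1 (i)**: "an *action of `π̂₁(A)` on `𝔾`* [is] the datum of a homomorphism
`ρ_𝔾 : π̂₁(A) → Aut(𝔾)` [where `Aut(𝔾)` denotes the group of automorphisms of `𝔾` as a totally
aloof, verticially slim semi-graph of anabelioids]" — here `PA` plays `π̂₁(A)` and `Aut G` is the
automorphism group in the ambient category of the interface. [cite: MochizukiSemiAnbd2006, Def 5.1 (i), p. 62] -/
abbrev ArithAction : Type (max v w) := PA →* Aut G

/-- **Def 5.1 (i)(a)**: "`π̂₁(A)` is topologically finitely generated" (the tree's
`AbsoluteAnabelian.IsTopologicallyFinitelyGenerated`, [AbsTopI] §0 = [SemiAnbd] Def 2.3 (iii) usage).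
[cite: MochizukiSemiAnbd2006, Def 5.1 (i)(a), p. 62] -/
def Def51CondA (PA : ProfiniteGrp.{w}) : Prop := AbsoluteAnabelian.IsTopologicallyFinitelyGenerated PA

/-- **Def 5.1 (i)(b)**: "the semi-graph `𝔾` is locally finite".
[cite: MochizukiSemiAnbd2006, Def 5.1 (i)(b), p. 62] -/
def Def51CondB (G : Obj) : Prop := 𝓥.IsLocallyFinite G

/-- **Def 5.1 (i)(c)** for the open subgroup `H ⊆ π̂₁(A)`: "the action of `H` on [the underlying
semi-graph] `𝔾` is trivial [it fixes every vertex and every branch, hence every edge]; the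
resulting outer homomorphism `H → Out(π̂₁(𝔾_v))`, where `v` ranges over the vertices of `𝔾`, is
continuous [relative to the natural profinite group topology on `Out(π̂₁(𝔾_v))`]".
(ERRATUM note, [IUTchI] Rmk 2.5.3 (vi) p.56: the author later strengthens (c) to a component-wise
(c^new) — continuity of `H → Aut(𝔾[c])` for the profinite topology (O2), not typed here for want of
that topology in the interface — and observes (O3) that since `H` is topologically finitely
generated, every finite index subgroup of `H` is open [NS], so (c) and (c^new) hold automatically.)
[cite: MochizukiSemiAnbd2006, Def 5.1 (i)(c), p. 62] -/
structure Def51CondC (H : OpenSubgroup PA) : Prop where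
  /-- `H` fixes every vertex of the underlying semi-graph -/
  fixesVert : ∀ h ∈ H, ∀ v : 𝓥.Vert G, 𝓥.mapV (ρ h).hom v = v
  /-- `H` fixes every branch (hence every edge) of the underlying semi-graph -/
  fixesBr : ∀ h ∈ H, ∀ x : (Σ e : 𝓥.Edge G, 𝓥.Br e), 𝓥.mapTotalBr (ρ h).hom x = x
  /-- the outer representation `H → Out(π̂₁(𝔾_v))` is continuous, for every vertex `v` -/
  continuous_outRep : ∀ v : 𝓥.Vert G,
    Continuous fun h : H => 𝓥.outRep (ρ h.1) v (fixesVert h.1 h.2 v)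

/-- **Def 5.1 (i)(d)** for `H` acting trivially on the vertices: "there is a finite set `V` of
vertices of `𝔾` such that for every vertex `w` of `𝔾`, there exists a `v ∈ V` and an isomorphism
of semi-graphs of anabelioids `𝔾[v] ⥲ 𝔾[w]` that is compatible with the action of `H` on both
sides" (the action of `h ∈ H` on `𝔾[v]` being the one induced by functoriality of localization,
`SemiAnbdVocab.locAutV`). [cite: MochizukiSemiAnbd2006, Def 5.1 (i)(d), p. 62] -/
def Def51CondD (H : OpenSubgroup PA) (hfix : ∀ h ∈ H, ∀ v : 𝓥.Vert G, 𝓥.mapV (ρ h).hom v = v) :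
    Prop :=
  ∃ S : Set (𝓥.Vert G), S.Finite ∧ ∀ w : 𝓥.Vert G, ∃ v ∈ S, ∃ i : 𝓥.locV G v ≅ 𝓥.locV G w,
    ∀ (h : PA) (hh : h ∈ H),
      i.hom ≫ (𝓥.locAutV (ρ h) w (hfix h hh w)).hom = (𝓥.locAutV (ρ h) v (hfix h hh v)).hom ≫ i.hom

/-- ERRATUM ([IUTchI] Rmk 2.5.3 (vi), kurims ms p.56 — typed BESIDE the printed (d), which it
does not replace): **(d^new)**, the author's later strengthening of (d) "in order to carry out the
argument stated in the proof of [SemiAnbd], Proposition 5.2, (i)": "there is a finite set `C*` of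
components [vertices and edges] of `𝔾` such that for every component `c` of `𝔾`, there exists a
`c* ∈ C*` and an isomorphism `𝔾[c] ⥲ 𝔾[c*]` compatible with the action of `H` on both sides".
Typed as: (d) for vertices together with the same condition for edges.  Source: [IUTchI]
Rmk 2.5.3 (vi) p.56. [claim: Mochizuki2012, status: disputed] -/
def Def51CondDNew (H : OpenSubgroup PA) (hfixV : ∀ h ∈ H, ∀ v : 𝓥.Vert G, 𝓥.mapV (ρ h).hom v = v)
    (hfixE : ∀ h ∈ H, ∀ e : 𝓥.Edge G, 𝓥.mapE (ρ h).hom e = e) : Prop :=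
  Def51CondD 𝓥 G PA ρ H hfixV ∧
    ∃ T : Set (𝓥.Edge G), T.Finite ∧ ∀ e : 𝓥.Edge G, ∃ e₀ ∈ T, ∃ i : 𝓥.locE G e₀ ≅ 𝓥.locE G e,
      ∀ (h : PA) (hh : h ∈ H),
        i.hom ≫ (𝓥.locAutE (ρ h) e (hfixE h hh e)).hom =
          (𝓥.locAutE (ρ h) e₀ (hfixE h hh e₀)).hom ≫ i.hom

/-- If `H` fixes every branch then it fixes every edge (an edge is determined by any of its
branches). [cite: MochizukiSemiAnbd2006, Def 5.1 (i)(c), p. 62] -/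
theorem fixesEdge_of_fixesBr (H : OpenSubgroup PA)
    (hBr : ∀ h ∈ H, ∀ x : (Σ e : 𝓥.Edge G, 𝓥.Br e), 𝓥.mapTotalBr (ρ h).hom x = x) :
    ∀ h ∈ H, ∀ e : 𝓥.Edge G, 𝓥.mapE (ρ h).hom e = e := by
  intro h hh e
  have hcard := 𝓥.natCard_br e
  have : Nonempty (𝓥.Br e) := by
    by_contra hne
    rw [not_nonempty_iff] at hne
    simp at hcard
  obtain ⟨b⟩ := this
  have := hBr h hh ⟨e, b⟩
  exact congrArg Sigma.fst this

/-- **Def 5.1 (i), continuity witnessed by `H`**: conditions (a)–(d) hold for the open subgroup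
`H ⊆ π̂₁(A)`. [cite: MochizukiSemiAnbd2006, Def 5.1 (i), p. 62] -/
structure IsContinuousActionAt (H : OpenSubgroup PA) : Prop where
  /-- (a) `π̂₁(A)` is topologically finitely generated -/
  condA : Def51CondA PA
  /-- (b) the underlying semi-graph is locally finite -/
  condB : Def51CondB 𝓥 G
  /-- (c) `H` acts trivially on the underlying semi-graph, with continuous outer representations -/
  condC : Def51CondC 𝓥 G PA ρ H
  /-- (d) finitely many `H`-equivariant isomorphism types of localizations `𝔾[w]` -/
  condD : Def51CondD 𝓥 G PA ρ H condC.fixesVert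

/-- **Def 5.1 (i)**: "an action of `π̂₁(A)` on `𝔾` is *continuous* if, for some open subgroup
`H ⊆ π̂₁(A)`, the conditions (a)–(d) are satisfied". [cite: MochizukiSemiAnbd2006, Def 5.1 (i), p. 62] -/
def IsContinuousAction (G : Obj) (PA : ProfiniteGrp.{w}) (ρ : PA →* Aut G) : Prop :=
  ∃ H : OpenSubgroup PA, IsContinuousActionAt 𝓥 G PA ρ H

end Def51

/-! ### Definition 5.1 (ii): connected arithmetic semi-graphs of anabelioids -/

/-- **Def 5.1 (ii)**: a *connected arithmetic semi-graph of anabelioids (over `A`)* is a triple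
`𝔊 = (𝔾, A, ρ_𝔾)` as in (i) with `ρ_𝔾` a continuous action: `𝔾` ("the geometric component") a
connected, coherent, totally aloof, verticially slim semi-graph of anabelioids, `A` ("the
arithmetic component") a slim connected anabelioid entering through `PA = π̂₁(A)`, `ρ` ("the
arithmetic action"). [cite: MochizukiSemiAnbd2006, Def 5.1 (ii), p. 62] -/
structure ArithSemiGraph where
  /-- the geometric component `𝔾` (an object of the ambient category: totally aloof, verticially slim) -/
  G : Obj
  /-- `𝔾` is connected (standing hypothesis of Def 5.1 (i)) -/
  connected : 𝓥.IsConnected G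
  /-- `𝔾` is coherent (standing hypothesis of Def 5.1 (i)) -/
  coherent : 𝓥.IsCoherent G
  /-- `π̂₁(A)`, the fundamental group of the arithmetic component (a profinite group) -/
  PA : ProfiniteGrp.{w}
  /-- `A` is slim (§0 p.6: iff `Z(H) = 1` for all open `H ⊆ π̂₁(A)`) -/
  slim : IsSlimGroup PA
  /-- the arithmetic action `ρ_𝔾 : π̂₁(A) → Aut(𝔾)` -/
  ρ : PA →* Aut G
  /-- the arithmetic action is continuous (Def 5.1 (i)) -/
  continuous : IsContinuousAction 𝓥 G PA ρ

/-! ### Definition 5.1 (iii): arithmetic semi-graphs of anabelioids (not necessarily connected) -/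

/-- **Def 5.1 (iii)**: an *arithmetic semi-graph of anabelioids* is "a formal collection of
connected arithmetic semi-graphs of anabelioids; each object in this collection will be referred
to as a connected component". [cite: MochizukiSemiAnbd2006, Def 5.1 (iii), p. 62] -/
structure ArithSemiGraphFamily where
  /-- the index set of connected components -/
  ι : Type w
  /-- the connected components -/
  comp : ι → ArithSemiGraph 𝓥

namespace ArithSemiGraphFamily

variable {𝓥}

/-- **Def 5.1 (iii)**: `𝔊` is *finite* if its geometric component [the disjoint union of the
geometric components of its connected components, p.63] is finite: finitely many components, each
finite. [cite: MochizukiSemiAnbd2006, Def 5.1 (iii), p. 63] -/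
def IsFinite (𝔉 : ArithSemiGraphFamily 𝓥) : Prop := Finite 𝔉.ι ∧ ∀ i, 𝓥.IsFinite (𝔉.comp i).G

/-- **Def 5.1 (iii)**: `𝔊` is *totally elevated* if its geometric component is so (vertex-wise
condition, hence component-wise). [cite: MochizukiSemiAnbd2006, Def 5.1 (iii), p. 63] -/
def IsTotallyElevated (𝔉 : ArithSemiGraphFamily 𝓥) : Prop := ∀ i, 𝓥.IsTotallyElevated (𝔉.comp i).G

/-- **Def 5.1 (iii)**: `𝔊` is *totally universally sub-coverticial* if its geometric component is
so. [cite: MochizukiSemiAnbd2006, Def 5.1 (iii), p. 63] -/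
def IsTotallyUnivSubcoverticial (𝔉 : ArithSemiGraphFamily 𝓥) : Prop :=
  ∀ i, 𝓥.IsTotallyUnivSubcoverticial (𝔉.comp i).G

/-- **Def 5.1 (iii)**: `𝔊` is *totally estranged* if its geometric component is so.
[cite: MochizukiSemiAnbd2006, Def 5.1 (iii), p. 63] -/
def IsTotallyEstranged (𝔉 : ArithSemiGraphFamily 𝓥) : Prop := ∀ i, 𝓥.IsTotallyEstranged (𝔉.comp i).G

/-- A connected arithmetic semi-graph of anabelioids as a one-component family.
[cite: MochizukiSemiAnbd2006, Def 5.1 (iii), p. 62] -/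
def single (𝔊 : ArithSemiGraph 𝓥) : ArithSemiGraphFamily 𝓥 := ⟨PUnit, fun _ => 𝔊⟩

end ArithSemiGraphFamily

/-! ### Definition 5.1 (iv): morphisms -/

/-- **Def 5.1 (iv)** (connected case, representative): a morphism `𝔊' → 𝔊` "consists of a pair
`π̂₁(A') → π̂₁(A)`; `𝔾' → 𝔾` [a continuous homomorphism of profinite groups and a morphism of
semi-graphs of anabelioids] which is compatible with `ρ_𝔾'`, `ρ_𝔾`" — regarded up to
`ArithHom.InnerEquiv`.  Special case typed: the geometric component is an arrow of the ambient
1-category (locally open), cf. the module docstring. [cite: MochizukiSemiAnbd2006, Def 5.1 (iv), p. 63] -/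
structure ArithHom (𝔊' 𝔊 : ArithSemiGraph 𝓥) where
  /-- the arithmetic component on fundamental groups `π̂₁(A') → π̂₁(A)` -/
  arith : 𝔊'.PA →* 𝔊.PA
  /-- it is continuous -/
  continuous_arith : Continuous arith
  /-- the geometric component `𝔾' → 𝔾` -/
  geom : 𝔊'.G ⟶ 𝔊.G
  /-- compatibility with the arithmetic actions: `f ∘ ρ'(a') = ρ(α a') ∘ f` -/
  compat : ∀ a' : 𝔊'.PA, (𝔊'.ρ a').hom ≫ geom = geom ≫ (𝔊.ρ (arith a')).hom

namespace ArithHom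

variable {𝓥} {𝔊' 𝔊 : ArithSemiGraph 𝓥}

/-- **Def 5.1 (iv)**: "which we regard up to composition with the inner action of `π̂₁(A)` on
`(𝔾, ρ_𝔾)`" [(i): `π̂₁(A)` acts on `π̂₁(A)` by conjugation and on `𝔾` via `ρ_𝔾`]: two representatives
define the same morphism when they differ by the inner action of some `a ∈ π̂₁(A)`.
[cite: MochizukiSemiAnbd2006, Def 5.1 (iv), p. 63] -/
def InnerEquiv (φ ψ : ArithHom 𝓥 𝔊' 𝔊) : Prop :=
  ∃ a : 𝔊.PA, (∀ a', ψ.arith a' = a * φ.arith a' * a⁻¹) ∧ ψ.geom = φ.geom ≫ (𝔊.ρ a).hom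

/-- The arithmetic component is *finite étale* as a morphism of connected anabelioids `A' → A`:
injective with open image on `π̂₁`. [cite: MochizukiSemiAnbd2006, Def 5.1 (iv), p. 63] -/
def IsArithFiniteEtale (φ : ArithHom 𝓥 𝔊' 𝔊) : Prop :=
  Function.Injective φ.arith ∧ IsOpen (Set.range φ.arith)

/-- The arithmetic component is an *isomorphism* of anabelioids: bijective on `π̂₁`.
[cite: MochizukiSemiAnbd2006, Def 5.1 (iv), p. 63] -/
def IsArithIso (φ : ArithHom 𝓥 𝔊' 𝔊) : Prop := Function.Bijective φ.arith

/-- **Def 5.1 (iv)** *finite étale*: geometric component finite étale, arithmetic component finite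
étale. [cite: MochizukiSemiAnbd2006, Def 5.1 (iv), p. 63] -/
def IsFiniteEtale (φ : ArithHom 𝓥 𝔊' 𝔊) : Prop := 𝓥.IsFiniteEtale φ.geom ∧ φ.IsArithFiniteEtale

/-- **Def 5.1 (iv)** *tempered*: geometric component a tempered covering [only defined for
countable `𝔾`], arithmetic component finite étale. [cite: MochizukiSemiAnbd2006, Def 5.1 (iv), p. 63] -/
def IsTempered (φ : ArithHom 𝓥 𝔊' 𝔊) : Prop := 𝓥.IsTempered φ.geom ∧ φ.IsArithFiniteEtale

/-- **Def 5.1 (iv)** *locally trivial*: geometric component locally trivial, arithmetic component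
an isomorphism. [cite: MochizukiSemiAnbd2006, Def 5.1 (iv), p. 63] -/
def IsLocallyTrivial (φ : ArithHom 𝓥 𝔊' 𝔊) : Prop := 𝓥.IsLocallyTrivial φ.geom ∧ φ.IsArithIso

/-- **Def 5.1 (iv)** *locally open*: geometric component locally open [automatic in the ambient
category of the interface], arithmetic component "a composite of a `π₁`-epimorphism with a finite
étale morphism", i.e. with open image. [cite: MochizukiSemiAnbd2006, Def 5.1 (iv), p. 63] -/
def IsLocallyOpen (φ : ArithHom 𝓥 𝔊' 𝔊) : Prop := IsOpen (Set.range φ.arith)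

/-- **Def 5.1 (iv)** *locally finite étale*: geometric component locally finite étale, arithmetic
component finite étale. [cite: MochizukiSemiAnbd2006, Def 5.1 (iv), p. 63] -/
def IsLocallyFiniteEtale (φ : ArithHom 𝓥 𝔊' 𝔊) : Prop :=
  𝓥.IsLocallyFiniteEtale φ.geom ∧ φ.IsArithFiniteEtale

/-- **Def 5.1 (iv)** *immersive*: geometric component an immersion [Def 4.1 (ii): locally trivial
with immersive underlying morphism of semi-graphs], arithmetic component an isomorphism.
[cite: MochizukiSemiAnbd2006, Def 5.1 (iv), p. 63] -/
def IsImmersive (φ : ArithHom 𝓥 𝔊' 𝔊) : Prop :=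
  (𝓥.IsLocallyTrivial φ.geom ∧ 𝓥.IsGraphImmersion φ.geom) ∧ φ.IsArithIso

/-- **Def 5.1 (iv)** *excisive*: geometric component an excision [Def 4.1 (ii)], arithmetic
component an isomorphism. [cite: MochizukiSemiAnbd2006, Def 5.1 (iv), p. 63] -/
def IsExcisive (φ : ArithHom 𝓥 𝔊' 𝔊) : Prop :=
  (𝓥.IsLocallyTrivial φ.geom ∧ 𝓥.IsGraphExcision φ.geom) ∧ φ.IsArithIso

/-- **Def 5.1 (iv)** *embedding*: geometric component an embedding [Def 4.1 (ii)], arithmetic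
component an isomorphism. [cite: MochizukiSemiAnbd2006, Def 5.1 (iv), p. 63] -/
def IsEmbedding (φ : ArithHom 𝓥 𝔊' 𝔊) : Prop :=
  (𝓥.IsLocallyTrivial φ.geom ∧ 𝓥.IsGraphEmbedding φ.geom) ∧ φ.IsArithIso

/-- **Def 5.1 (iv)** *BC-finite étale* ["BC" = "base of constants"]: geometric component an
isomorphism, arithmetic component finite étale. [cite: MochizukiSemiAnbd2006, Def 5.1 (iv), p. 63] -/
def IsBCFiniteEtale (φ : ArithHom 𝓥 𝔊' 𝔊) : Prop := IsIso φ.geom ∧ φ.IsArithFiniteEtale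

/-- An *isomorphism* of connected arithmetic semi-graphs of anabelioids (both components
isomorphisms; used in Prop 5.2 (ii) "isomorphic as tempered coverings over `𝔊`").
[cite: MochizukiSemiAnbd2006, Prop 5.2 (ii), p. 63] -/
def IsIsomorphism (φ : ArithHom 𝓥 𝔊' 𝔊) : Prop := IsIso φ.geom ∧ φ.IsArithIso

/-- Inner equivalence is reflexive. [cite: MochizukiSemiAnbd2006, Def 5.1 (iv), p. 63] -/
theorem InnerEquiv.refl (φ : ArithHom 𝓥 𝔊' 𝔊) : InnerEquiv φ φ :=
  ⟨1, fun a' => by simp, by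
    have : (𝔊.ρ 1).hom = 𝟙 𝔊.G := by rw [map_one]; rfl
    rw [this, Category.comp_id]⟩

end ArithHom


end Literature.AnabelianGeometry.SemiGraphs
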